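import Summits.CriticalPhenomena.SAWScalingLimit.Theorems.SAWDefectDecoherenceBoundaryClosureRBoundaryDataTransferLatticeFrame
import Summits.CriticalPhenomena.SAWScalingLimit.Theorems.SAWDefectDecoherenceBoundaryClosureRBoundaryDataTransferLimitFrame
import HarnessLib

/-!
# Boundary data transfer, IX: the limit at the floor sites of a pinned flat piece

Route `SAWDefectDecoherence`, crux `BoundaryClosureR` (stmt-CriticalPhenomena-14004), line
`pick-half-plane`, stub `stub_engineBoundaryData` (r13).  The exact lattice identities of the
boundary data (arms, flat segments, window sums) live at the FLOOR SITES `![k, M]` of the pinned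
row `M`, which may lie slightly below the flat piece; this file evaluates an engine limit `h` there:

* `floorSite_value` — in the frame of a pinned flat piece (gate or root piece), for a point `z ≠ x`
  of the piece and `ε > 0`, eventually along the mesh sequence the floor site
  `![⌊re z/δ − M/2⌋, M]` lies over a cell of `Λ δ`, within `ε` of `z`, and `‖h_δ − h z‖ ≤ ε` there
  (`site_value` + `flat_window` + `pinned_frame`);
* `rootColumns` / `boundaryDataTransfer_rootColumns` (registered) — at a good scale of the root
  frame, the root column and the column under a point of the root piece lie in the integer window
  of the flat-floor clauses, on the correct side of each other.
-/

noncomputable section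

open scoped Topology
open Filter Set
open Literature.Probability.LatticeModels Literature.Probability.RandomPlanarGeometry
open Literature.Probability.RandomPlanarGeometry.SAW
open Summit.CriticalPhenomena.SAWScalingLimit.Theorems.PickHalfPlane.RootWedge
open Summit.CriticalPhenomena.SAWScalingLimit.Theorems.PickHalfPlane.DevelopingMaps

namespace Summit.CriticalPhenomena.SAWScalingLimit.Theorems.PickHalfPlane.BoundaryDataTransfer

/-! ### Columns at a good scale of the root frame -/

/-- **Columns at a good scale of the root frame.**  With the root `e = floorEdge ka M` within `ε_f`
of `x` (`ε_f ≤ r/8`, `δ ≤ r/4`): the root column `ka` and the column `⌊re z/δ − M/2⌋` under a point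
`z` with `|re z − re x| < r/2` lie in the integer window of real half-width `3r/4` about `re x`;
the latter is east of `ka` if `re x + ε_f + δ < re z` and west of it if `re z + ε_f + δ < re x`.
[folklore] -/
theorem rootColumns {δ r : ℝ} (hδ0 : 0 < δ) (hδr : δ ≤ r / 4) {x : ℂ} {M ka : ℤ} {εf : ℝ}
    {ee : Sym2 HexVertex} (he : ee = floorEdge ka M) (hnear : ‖(δ : ℂ) * hexMidpoint ee - x‖ < εf)
    (hεf : εf ≤ r / 8) {z : ℂ} (hzx : |z.re - x.re| < r / 2) :
    (⌈(x.re - 3 * r / 4) / δ - M / 2⌉ ≤ ka ∧ ka ≤ ⌊(x.re + 3 * r / 4) / δ - M / 2⌋) ∧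
    (⌈(x.re - 3 * r / 4) / δ - M / 2⌉ ≤ ⌊z.re / δ - M / 2⌋ ∧
      ⌊z.re / δ - M / 2⌋ ≤ ⌊(x.re + 3 * r / 4) / δ - M / 2⌋) ∧
    (x.re + εf + δ < z.re → ka < ⌊z.re / δ - M / 2⌋) ∧
    (z.re + εf + δ < x.re → ⌊z.re / δ - M / 2⌋ < ka) := by
  have hka : |δ * (ka + M / 2) + δ / 2 - x.re| < εf := by
    have h1 := Complex.abs_re_le_norm ((δ : ℂ) * hexMidpoint ee - x)
    rw [Complex.sub_re, he, re_scaled_hexMidpoint_floorEdge] at h1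
    exact lt_of_le_of_lt h1 (by rw [← he]; exact hnear)
  have hcol := floorColumn_near hδ0 z.re M
  rw [abs_lt] at hka hzx
  refine ⟨mem_Icc_window hδ0 ?_, mem_Icc_window hδ0 ?_, fun hlt => ?_, fun hlt => ?_⟩
  · rw [abs_lt]; constructor <;> linarith
  · rw [abs_lt]; constructor <;> nlinarith [hcol.1, hcol.2]
  · have : (ka : ℝ) < ⌊z.re / δ - M / 2⌋ := by
      by_contra hc
      have hc' : ((⌊z.re / δ - M / 2⌋ : ℤ) : ℝ) ≤ ka := not_lt.1 hc
      nlinarith [hcol.1, mul_le_mul_of_nonneg_left hc' hδ0.le]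
    exact_mod_cast this
  · have : ((⌊z.re / δ - M / 2⌋ : ℤ) : ℝ) < ka := by
      by_contra hc
      have hc' : (ka : ℝ) ≤ ⌊z.re / δ - M / 2⌋ := not_lt.1 hc
      nlinarith [hcol.2, mul_le_mul_of_nonneg_left hc' hδ0.le]
    exact_mod_cast this

/-- **Registered helper `boundaryDataTransfer_rootColumns`** (crux stmt-CriticalPhenomena-14004, line
`pick-half-plane`, stub `stub_engineBoundaryData`): the column bookkeeping of the root frame at one
scale, ∀-closed (`rootColumns`). [folklore] -/
theorem boundaryDataTransfer_rootColumns : ∀ (δ r εf : ℝ) (x z : ℂ) (M ka : ℤ) (ee : Sym2 HexVertex), 0 < δ → δ ≤ r / 4 → ee = floorEdge ka M → ‖(δ : ℂ) * hexMidpoint ee - x‖ < εf → εf ≤ r / 8 → |z.re - x.re| < r / 2 → (⌈(x.re - 3 * r / 4) / δ - M / 2⌉ ≤ ka ∧ ka ≤ ⌊(x.re + 3 * r / 4) / δ - M / 2⌋) ∧ (⌈(x.re - 3 * r / 4) / δ - M / 2⌉ ≤ ⌊z.re / δ - M / 2⌋ ∧ ⌊z.re / δ - M / 2⌋ ≤ ⌊(x.re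 + 3 * r / 4) / δ - M / 2⌋) ∧ (x.re + εf + δ < z.re → ka < ⌊z.re / δ - M / 2⌋) ∧ (z.re + εf + δ < x.re → ⌊z.re / δ - M / 2⌋ < ka) :=
  fun _ _ _ _ _ _ _ _ hδ0 hδr he hnear hεf hzx => rootColumns hδ0 hδr he hnear hεf hzx

section Frame

/-! ### The limit at the floor sites -/


variable {D : DobrushinDomain} {ρ : ℝ} {Λ : ℝ → Finset HexVertex} {m : ℝ → ℤ} {b : ℝ → Sym2 HexVertex}
  (hAF : 0 < ρ ∧
    D.carrier ∩ Metric.ball (D.pt 1) ρ = {z : ℂ | (D.pt 1).im < z.im} ∩ Metric.ball (D.pt 1) ρ ∧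
    (∀ᶠ δ : ℝ in 𝓝[>] 0, hexDomainSimplyConnected (Λ δ) ∧ b δ ∈ hexDomainBoundary (Λ δ) ∧
      (hexGraph.induce ((Λ δ : Finset HexVertex) : Set HexVertex)).Preconnected ∧
      (∀ v ∈ Λ δ, (δ : ℂ) * hexCenter v ∈ D.carrier) ∧
      (∀ v : HexVertex, (δ : ℂ) * hexCenter v ∈ Metric.ball (D.pt 1) ρ →
        (v ∈ Λ δ ↔ m δ ≤ v.1 1))) ∧
    (∀ K : Set ℂ, IsCompact K → K ⊆ D.carrier →
      ∀ᶠ δ : ℝ in 𝓝[>] 0, ∀ v : HexVertex, (δ : ℂ) * hexCenter v ∈ K → v ∈ Λ δ) ∧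
    Tendsto (fun δ : ℝ => (δ : ℂ) * hexMidpoint (b δ)) (𝓝[>] 0) (𝓝 (D.pt 1)))
  {x : ℂ} {e : ℝ → Sym2 HexVertex} {r : ℝ} {mr : ℝ → ℤ}
  (hPR : 0 < r ∧ D.carrier ∩ Metric.ball x r = {z : ℂ | x.im < z.im} ∩ Metric.ball x r ∧
    (∀ᶠ δ : ℝ in 𝓝[>] 0, e δ ∈ hexDomainBoundary (Λ δ) ∧
      Nonempty (HexMidEdgeSAW (Λ δ) (e δ) (b δ)) ∧
      (∀ v : HexVertex, (δ : ℂ) * hexCenter v ∈ Metric.ball x r → (v ∈ Λ δ ↔ mr δ ≤ v.1 1))) ∧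
    Tendsto (fun δ : ℝ => (δ : ℂ) * hexMidpoint (e δ)) (𝓝[>] 0) (𝓝 x))
  (hx : x ≠ D.pt 1)
  (hSup : ∀ K : Set ℂ, IsCompact K →
    K ⊆ D.carrier ∪ (({z : ℂ | z.im = (D.pt 1).im} ∩ Metric.ball (D.pt 1) ρ) ∪
      ({z : ℂ | z.im = x.im} ∩ Metric.ball x r)) → x ∉ K →
    ∃ C : ℝ, ∀ᶠ δ : ℝ in 𝓝[>] 0, ∀ z ∈ hexDomainMidEdges (Λ δ), (δ : ℂ) * hexMidpoint z ∈ K →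
      ‖hexParafermionicObservable (Λ δ) (e δ) hexCriticalFugacity (5 / 8) z‖ ≤
        C * ‖hexParafermionicObservable (Λ δ) (e δ) hexCriticalFugacity (5 / 8) (b δ)‖)
  {ns : ℕ → ℝ} (hns : Tendsto ns atTop (𝓝[>] 0)) {h : ℂ → ℂ}
  (hcont : ContinuousOn h ((D.carrier ∪ (({z : ℂ | z.im = (D.pt 1).im} ∩ Metric.ball (D.pt 1) ρ) ∪
    ({z : ℂ | z.im = x.im} ∩ Metric.ball x r))) \ {x}))
  (hconv : ∀ K : Set ℂ, IsCompact K →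
    K ⊆ (D.carrier ∪ (({z : ℂ | z.im = (D.pt 1).im} ∩ Metric.ball (D.pt 1) ρ) ∪
      ({z : ℂ | z.im = x.im} ∩ Metric.ball x r))) \ {x} →
    ∀ ε : ℝ, 0 < ε → ∀ᶠ n : ℕ in atTop, ∀ H : Site 2 → ℂ, IsPotential (Λ (ns n)) (e (ns n)) H →
      ∀ (ub wb : HexVertex), b (ns n) = s(ub, wb) →
      ∀ sb : Site 2, sb ∈ hexFaceVertices ub → sb ∈ hexFaceVertices wb →
      ∀ s : Site 2, IsLatticeSite (Λ (ns n)) s → ((ns n : ℝ) : ℂ) * triEmbed s ∈ K →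
        ‖((ns n : ℝ) : ℂ) * (H s - H sb) /
              hexParafermionicObservable (Λ (ns n)) (e (ns n)) hexCriticalFugacity (5 / 8) (b (ns n)) -
            h (((ns n : ℝ) : ℂ) * triEmbed s)‖ < ε)

include hAF hPR hx hSup hns hcont hconv

/-- **The limit at the floor site under a flat point.**  In the frame of a pinned flat piece (the
carrier is the open half-ball above `p₀` inside `ball p₀ R₀`, lattice pin with threshold row
`mf δ`, a boundary mid-edge `bf δ` with `δ·mid(bf δ) → p₀`), for a point `z ≠ x` of the piece in
`U` and `ε > 0`: eventually along the mesh sequence, for every potential and normaliser site, the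
FLOOR SITE `![⌊re z/δ − mf δ/2⌋, mf δ]` lies over a cell of `Λ δ`, within `ε` of `z` (possibly below
the piece), and has `‖h_δ − h z‖ ≤ ε` there (`site_value`). [cite: DuminilCopinSmirnov2012, §4 (precompactness of the maps H_δ)] -/
theorem floorSite_value {p₀ : ℂ} {R₀ : ℝ} {mf : ℝ → ℤ} {bf : ℝ → Sym2 HexVertex} (hR₀ : 0 < R₀)
    (hΩ : D.carrier ∩ Metric.ball p₀ R₀ = {z : ℂ | p₀.im < z.im} ∩ Metric.ball p₀ R₀)
    (hpin : ∀ᶠ δ : ℝ in 𝓝[>] 0, ∀ v : HexVertex,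
      (δ : ℂ) * hexCenter v ∈ Metric.ball p₀ R₀ → (v ∈ Λ δ ↔ mf δ ≤ v.1 1))
    (hbd : ∀ᶠ δ : ℝ in 𝓝[>] 0, bf δ ∈ hexDomainBoundary (Λ δ))
    (hlim : Tendsto (fun δ : ℝ => (δ : ℂ) * hexMidpoint (bf δ)) (𝓝[>] 0) (𝓝 p₀))
    {z : ℂ} (hzU : z ∈ (D.carrier ∪ (({z : ℂ | z.im = (D.pt 1).im} ∩ Metric.ball (D.pt 1) ρ) ∪
      ({z : ℂ | z.im = x.im} ∩ Metric.ball x r))) \ {x})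
    (hzim : z.im = p₀.im) (hzR : ‖z - p₀‖ < R₀) {ε : ℝ} (hε : 0 < ε) :
    ∀ᶠ n : ℕ in atTop, ∀ H : Site 2 → ℂ, IsPotential (Λ (ns n)) (e (ns n)) H →
      ∀ (ub wb : HexVertex), b (ns n) = s(ub, wb) →
      ∀ sb : Site 2, sb ∈ hexFaceVertices ub → sb ∈ hexFaceVertices wb →
        upFace ⌊z.re / ns n - mf (ns n) / 2⌋ (mf (ns n)) ∈ Λ (ns n) ∧
        ‖((ns n : ℝ) : ℂ) * triEmbed ![⌊z.re / ns n - mf (ns n) / 2⌋, mf (ns n)] - z‖ ≤ ε ∧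
        ‖((ns n : ℝ) : ℂ) * (H ![⌊z.re / ns n - mf (ns n) / 2⌋, mf (ns n)] - H sb) /
              hexParafermionicObservable (Λ (ns n)) (e (ns n)) hexCriticalFugacity (5 / 8) (b (ns n)) -
            h z‖ ≤ ε := by
  obtain ⟨θ, hθ, hval⟩ := site_value hAF hPR hx hSup hns hcont hconv hzU hε
  have hΛΩ := hAF.2.2.1.mono fun _ h => h.2.2.2.1
  set R' : ℝ := (R₀ + ‖z - p₀‖) / 2 with hR'
  have hR'R : R' < R₀ := by rw [hR']; linarith
  have hW := flat_window hR'R hpin hbd hlim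
  set τ : ℝ := min (min θ ε) (R₀ - ‖z - p₀‖) / 4 with hτ
  have hmin : 0 < min (min θ ε) (R₀ - ‖z - p₀‖) := lt_min (lt_min hθ hε) (by linarith)
  have hτ0 : 0 < τ := by positivity
  have hτθ : 4 * τ ≤ θ := by
    have := (min_le_left (min θ ε) (R₀ - ‖z - p₀‖)).trans (min_le_left θ ε); rw [hτ]; linarith
  have hτε : 4 * τ ≤ ε := by
    have := (min_le_left (min θ ε) (R₀ - ‖z - p₀‖)).trans (min_le_right θ ε); rw [hτ]; linarith
  have hτR : 4 * τ ≤ R₀ - ‖z - p₀‖ := by have := min_le_right (min θ ε) (R₀ - ‖z - p₀‖); rw [hτ]; linarith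
  have hF := pinned_frame hR₀ hτ0 hΩ hpin hbd hΛΩ hlim
  have hδev : ∀ᶠ δ : ℝ in 𝓝[>] 0, δ ∈ Set.Ioo 0 τ := Ioo_mem_nhdsGT hτ0
  filter_upwards [hval, hns.eventually hW, hns.eventually hF, hns.eventually hδev] with n hvaln hWn
    ⟨_, _, _, hht⟩ ⟨hδ0, hδτ⟩ H hH ub wb hb sb hsbu hsbw
  set δ : ℝ := ns n with hδ
  set M : ℤ := mf δ with hM
  set a : ℤ := ⌊z.re / δ - M / 2⌋ with ha
  have hzim' : |δ * (M : ℝ) * (Real.sqrt 3 / 2) - z.im| < τ := by rw [hzim]; exact hht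
  have hdist : ‖(δ : ℂ) * triEmbed ![a, M] - z‖ ≤ δ + τ := norm_floorSite_sub_le hδ0 M z hzim'
  have hcol := floorColumn_near hδ0 z.re M
  have hre : |z.re - p₀.re| ≤ ‖z - p₀‖ := by
    have := Complex.abs_re_le_norm (z - p₀); rwa [Complex.sub_re] at this
  have hup : upFace a M ∈ Λ δ := by
    refine (hWn a ?_).1
    have h1 : |δ * (a + M / 2) - z.re| ≤ δ := by
      rw [abs_le]; constructor <;> linarith [hcol.1, hcol.2]
    calc |δ * (a + M / 2) - p₀.re| ≤ |δ * (a + M / 2) - z.re| + |z.re - p₀.re| := abs_sub_le _ _ _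
      _ ≤ δ + ‖z - p₀‖ := add_le_add h1 hre
      _ ≤ R' := by rw [hR']; linarith
  refine ⟨hup, ?_, hvaln H hH ub wb hb sb hsbu hsbw _ (isLatticeSite_floorSite hup) (hdist.trans (by linarith))⟩
  linarith

end Frame

end Summit.CriticalPhenomena.SAWScalingLimit.Theorems.PickHalfPlane.BoundaryDataTransfer

end
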